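/-
Origin: expansion seat `prover-pub-hodgecm-mc-sinst-1-g9-0`, handover #1237 2026-08-20T20:38Z md5 98cc2a9a1407 (129 l.; NEW additive generic-algebra leaf, ns HodgeCM.EquivariantLift; imports Mathlib.RepresentationTheory.Basic only; `lift ρ f hf : ρ.asModule →ₗ[MonoidAlgebra k G] H` (equivariant k-linear map out of a Representation into a k[G]-module = k[G]-linear map, Mathlib `equivariantOfLinearOfComm` after `asModuleEquiv`), `lift_apply`/`lift_symm_apply`, `restrictScalars_range_lift`, `mem_range_lift`, `mem_iSup_range_of_equivariant` (the `oscImage` shape of axioms-1's dictionary), `range_le_iSup_range_of_equivariant`, `of_smul_eq_self_of_forall_eq`/`_mem_subgroup` (fixed ↦ fixed = unfolded `fixedBy`), abbrev `pullback ρ e := ρ.comp e`; NAME LIST: HodgeCM.EquivariantLift.restrictScalars_range_lift · HodgeCM.EquivariantLift.mem_iSup_range_of_equivariant · HodgeCM.EquivariantLift.of_smul_eq_self_of_forall_eq) (`HOME/mc/pub-hodgecm-mc-sinst-1-g9/stage/HodgeCM/Model/Binders/EquivariantLift.lean`, md5 98cc2a9a1407, 129 lines);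
landed by the gen-26 packager (p-g26) in gate run 63 as `HodgeCM/Model/Binders/EquivariantLift.lean` (verbatim).
-/
/-
Copyright (c) 2026 the pub-hodgecm formalisation cell (harness21).  New file, not vendored.
Origin: session prover-pub-hodgecm-mc-sinst-1-g9-0 (unit pub-hodgecm-mc-sinst-1-g9, S-INSTANCE CONSTRUCTOR gen 9; (J4) side of the
(J-Liu-Θ) junction behind E's row 9 `hΘ`), 2026-08-20.
Intended final place: `HodgeCM/Model/Binders/EquivariantLift.lean` (NEW additive generic-algebra leaf; imports
`Mathlib.RepresentationTheory.Basic` only; nothing imports it yet; drop alone on bounce).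
-/
import Mathlib.RepresentationTheory.Basic

set_option autoImplicit false

/-!
# Equivariant `k`-linear maps out of a representation as `k[G]`-linear maps on `ρ.asModule`

The (J3) dictionary of row 9 (`Literature/AlbaneseUnitaryShimuraModules`, axioms-1) types [Liu21]'s carriers as modules over the
group algebra `A = MonoidAlgebra ℂ G` and reads the oscillator images through `A`-LINEAR maps `ψ : Ω →ₗ[A] H`
(`oscImage t = ⨆ ψ, range ψ`), while the (J4) side produces Mathlib `Representation`s (`adelicThetaRep`, sinst-1) and the
(J2) side produces a `ℂ`-linear, `G`-equivariant class map into the tower `H` (binder-1).  This leaf is the one-screen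
adapter between the two currencies, GENERIC in `(k, G)`:

* `lift ρ f hf : ρ.asModule →ₗ[MonoidAlgebra k G] H` — a `k`-linear map `f : M → H` out of a representation
  `ρ : Representation k G M` into a `k[G]`-module `H` (with `IsScalarTower k k[G] H`) which is equivariant,
  `f (ρ g m) = of g • f m`, IS a `k[G]`-linear map on the type synonym `ρ.asModule` (Mathlib
  `MonoidAlgebra.equivariantOfLinearOfComm` after `Representation.asModuleEquiv`); `lift_apply`, `lift_symm_apply`;
* `restrictScalars_range_lift : (range (lift ρ f hf)).restrictScalars k = range f` and the two membership forms the junction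
  reads: `mem_range_lift` and **`mem_iSup_range_of_equivariant`** (`f m ∈ ⨆ ψ : ρ.asModule →ₗ[k[G]] H, range ψ` — the
  shape of `LiuAlbaneseModuleDatum.oscImage` once `Ω t := ρ.asModule`);
* `of_smul_eq_self_of_forall_eq` — an equivariant `f` carries `K`-fixed vectors of `ρ` to `K`-fixed vectors of `H`
  (`∀ g ∈ K, of g • f m = f m`, the unfolded `fixedBy K H` of the dictionary).

KERNEL only (Mathlib algebra): 0 records, 0 `def … : Prop`, nothing cited; `#print axioms` ⊆ {propext, Classical.choice, Quot.sound}.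
-/

namespace HodgeCM
namespace EquivariantLift

open Representation

section Monoid

variable {k G : Type*} [CommSemiring k] [Monoid G]
variable {M : Type*} [AddCommMonoid M] [Module k M] (ρ : Representation k G M)
variable {H : Type*} [AddCommMonoid H] [Module k H] [Module (MonoidAlgebra k G) H]
  [IsScalarTower k (MonoidAlgebra k G) H]
variable (f : M →ₗ[k] H)

/-- **An equivariant `k`-linear map out of a representation, as a `k[G]`-linear map on `ρ.asModule`.** [folklore] -/
noncomputable def lift (hf : ∀ (g : G) (m : M), f (ρ g m) = MonoidAlgebra.of k G g • f m) :
    ρ.asModule →ₗ[MonoidAlgebra k G] H :=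
  MonoidAlgebra.equivariantOfLinearOfComm (f ∘ₗ ρ.asModuleEquiv.toLinearMap) fun g v => by
    simp only [LinearMap.coe_comp, LinearEquiv.coe_coe, Function.comp_apply, asModuleEquiv_map_smul,
      asAlgebraHom_single, one_smul, hf, MonoidAlgebra.of_apply]

variable (hf : ∀ (g : G) (m : M), f (ρ g m) = MonoidAlgebra.of k G g • f m)

/-- `lift ρ f hf v = f v` (the type synonym read through `asModuleEquiv`). [folklore] -/
@[simp] theorem lift_apply (v : ρ.asModule) : lift ρ f hf v = f (ρ.asModuleEquiv v) := rfl

/-- `lift ρ f hf (asModuleEquiv.symm m) = f m`. [folklore] -/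
@[simp] theorem lift_symm_apply (m : M) : lift ρ f hf (ρ.asModuleEquiv.symm m) = f m := rfl

/-- The range of the lift, as a `k`-subspace of `H`, is the range of `f`. [folklore] -/
theorem restrictScalars_range_lift :
    (LinearMap.range (lift ρ f hf)).restrictScalars k = LinearMap.range f := by
  ext x
  simp only [Submodule.restrictScalars_mem, LinearMap.mem_range, lift_apply]
  constructor
  · rintro ⟨v, rfl⟩
    exact ⟨ρ.asModuleEquiv v, rfl⟩
  · rintro ⟨m, rfl⟩
    exact ⟨ρ.asModuleEquiv.symm m, rfl⟩

/-- Every value `f m` lies in the range of the lift. [folklore] -/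
theorem mem_range_lift (m : M) : f m ∈ LinearMap.range (lift ρ f hf) :=
  ⟨ρ.asModuleEquiv.symm m, rfl⟩

include hf in
/-- **The `oscImage` shape**: every value of an equivariant `f` lies in the sum of the ranges of all `k[G]`-linear maps
`ρ.asModule → H` (read as a `k`-subspace). [folklore] -/
theorem mem_iSup_range_of_equivariant (m : M) :
    f m ∈ ⨆ ψ : ρ.asModule →ₗ[MonoidAlgebra k G] H, (LinearMap.range ψ).restrictScalars k := by
  have h : (LinearMap.range (lift ρ f hf)).restrictScalars k ≤
      ⨆ ψ : ρ.asModule →ₗ[MonoidAlgebra k G] H, (LinearMap.range ψ).restrictScalars k :=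
    le_iSup (fun ψ : ρ.asModule →ₗ[MonoidAlgebra k G] H => (LinearMap.range ψ).restrictScalars k) (lift ρ f hf)
  exact h (mem_range_lift ρ f hf m)

include hf in
/-- The whole range of an equivariant `f` lies in that sum. [folklore] -/
theorem range_le_iSup_range_of_equivariant :
    LinearMap.range f ≤ ⨆ ψ : ρ.asModule →ₗ[MonoidAlgebra k G] H, (LinearMap.range ψ).restrictScalars k := by
  rintro _ ⟨m, rfl⟩
  exact mem_iSup_range_of_equivariant ρ f hf m

omit [IsScalarTower k (MonoidAlgebra k G) H] in
include hf in
/-- **Fixed vectors go to fixed vectors**: if `ρ g m = m` for all `g ∈ K` then `of g • f m = f m` for all `g ∈ K`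
(the unfolded membership `f m ∈ fixedBy K H` of the (J3) dictionary). [folklore] -/
theorem of_smul_eq_self_of_forall_eq {K : Set G} {m : M} (hm : ∀ g ∈ K, ρ g m = m) :
    ∀ g ∈ K, MonoidAlgebra.of k G g • f m = f m := fun g hg => by
  rw [← hf, hm g hg]

end Monoid

section Group

variable {k G : Type*} [CommSemiring k] [Group G]
variable {M : Type*} [AddCommMonoid M] [Module k M] (ρ : Representation k G M)
variable {H : Type*} [AddCommMonoid H] [Module k H] [Module (MonoidAlgebra k G) H]
  [IsScalarTower k (MonoidAlgebra k G) H]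
variable (f : M →ₗ[k] H) (hf : ∀ (g : G) (m : M), f (ρ g m) = MonoidAlgebra.of k G g • f m)

omit [IsScalarTower k (MonoidAlgebra k G) H] in
include hf in
/-- `Subgroup` form of `of_smul_eq_self_of_forall_eq`. [folklore] -/
theorem of_smul_eq_self_of_forall_mem_subgroup (K : Subgroup G) {m : M} (hm : ∀ g ∈ K, ρ g m = m) :
    ∀ g ∈ K, MonoidAlgebra.of k G g • f m = f m :=
  of_smul_eq_self_of_forall_eq ρ f hf (K := (K : Set G)) hm

/-- **Pull-back of a representation along a group homomorphism** `e : G' →* G` (e.g. the finite-adèlic factor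
`U(V)(𝔸_f) →* G_U(𝔸)`): `(ρ.comp e) g' = ρ (e g')`.  (Mathlib's `MonoidHom.comp`, named for the junction's readers.) [folklore] -/
abbrev pullback {G' : Type*} [Group G'] (e : G' →* G) : Representation k G' M := ρ.comp e

/-- (Ported verbatim from the HodgeCMPerL package; no docstring in the source.) -/
@[simp] theorem pullback_apply {G' : Type*} [Group G'] (e : G' →* G) (g' : G') :
    pullback ρ e g' = ρ (e g') := rfl

end Group

end EquivariantLift
end HodgeCM
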